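import Literature.Analysis.FunctionSpaces.TorusTranslationEstimate
import Literature.Analysis.OperatorTheory.BorelFunctionalCalculus
import Mathlib.Analysis.SpecialFunctions.Trigonometric.Sinc
import Mathlib.MeasureTheory.Function.LpSpace.Basic
import HarnessLib

/-!
# Lipschitz maps act on the spectral `H¹` of the flat torus; the clamp truncation is a contraction

Analysis/FunctionSpaces support file (everything proved; no definitions, no named facts; global
`volume` convention of `FlatTorus`, results stated through `UnitAddTorus.mFourierCoeff`, which does
not depend on the convention). For `g ∈ L²(T^d; ℂ)`, a `K`-Lipschitz map `Φ : ℂ → ℂ` with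
`Φ 0 = 0` and a coordinate `p : d`,

  `∑ₙ nₚ² ‖𝓕(Φ ∘ g)(n)‖² ≤ K² ∑ₙ nₚ² ‖𝓕g(n)‖²`     (`Torus.tsum_sq_mul_enorm_mFourierCoeff_comp_le`),

in `ℝ≥0∞` (both sides may be `∞`), and the weighted form with weights `∑ₚ cₚ nₚ²`, `cₚ ≥ 0`
(`Torus.tsum_weight_mul_enorm_mFourierCoeff_comp_le`): Lipschitz maps are bounded on the
Fourier-side Sobolev space `H¹(T^d)` and `1`-Lipschitz maps contract the kinetic energy
`‖∇u‖₂²`. This is the spectral counterpart of the chain rule `∇(Φ ∘ u) = Φ'(u)∇u` for Lipschitz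
`Φ` (Gilbarg–Trudinger, Lemma 7.6 and Thm. 7.8; Marcus–Mizel 1972) and avoids weak derivatives
altogether. Proof: the difference-quotient characterisation of `H¹` — by Parseval
`∫ ‖u(· + a) - u‖² = ∑ₙ |e_n(a) - 1|² |û(n)|²` (`Torus.lintegral_enorm_sub_translate_sq_eq_tsum`),
`Φ` contracts the left-hand side pointwise, and at the one-coordinate translation `a = s·𝐞ₚ`
one has `|e_n(a) - 1|² = (2πs)² (nₚ sinc(π nₚ s))²` with `(nₚ sinc(π nₚ s))² → nₚ²` as `s → 0`
(and `≤ nₚ²` since `|sinc| ≤ 1`); the limit is taken on finite partial sums.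

The standard bounded truncation used with it is the componentwise **clamp**
`Literature.Analysis.OperatorTheory.clampC k` (`BorelFunctionalCalculus`): we add that it is
`1`-Lipschitz, fixes the disc `‖z‖ ≤ k`, satisfies `‖clampC k z‖ ≤ ‖z‖`, tends to the identity as
`k → ∞`, and therefore contracts the weighted kinetic energy
(`Torus.tsum_weight_mul_enorm_mFourierCoeff_clampC_le`).

## Mathlib / tree search

Mathlib: `LipschitzWith.comp_memLp`, `LipschitzWith.compLp` (Lipschitz maps act on `Lp`), `Real.sinc`,
`Complex.norm_exp_I_mul_ofReal_sub_one`; no Sobolev space on the torus, no chain rule for Lipschitz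
maps in `W^{1,p}` (searched `LipschitzWith.*fderiv.*ae`, `MemSobolev.*comp`). Tree:
`Torus.lintegral_enorm_sub_translate_sq_eq_tsum` (`TorusTranslationEstimate`), `TorusChainRule`
(smooth outer functions only), `LipschitzTruncation` (Euclidean, Acerbi–Fusco; unrelated statement),
`Literature.Analysis.OperatorTheory.clampC` with `continuous_clampC`, `norm_clampC_le`, `abs_clamp_le`.

## References

* D. Gilbarg, N. S. Trudinger, *Elliptic Partial Differential Equations of Second Order*, Springer
  (2001 reprint), Lemma 7.6, Thm. 7.8 (chain rule for Lipschitz maps, truncation in `W^{1,p}`).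
* M. Marcus, V. J. Mizel, *Absolute continuity on tracks and mappings of Sobolev spaces*, Arch.
  Rational Mech. Anal. 45 (1972) 294–320.
* L. Grafakos, *Classical Fourier Analysis*, 3rd ed. (2014), Prop. 3.2.7 (3) (Parseval on `𝕋ⁿ`).
-/

noncomputable section

open MeasureTheory Set Filter Topology UnitAddTorus
open scoped ENNReal NNReal

namespace Literature.Analysis.FunctionSpaces

open Literature.Analysis.OperatorTheory

/-! ## The clamp `clampC k` is a `1`-Lipschitz contraction fixing the disc of radius `k` -/

section Clamp

/-- The one-dimensional clamp `x ↦ max(-k, min(k, x))` does not increase absolute values (`k ≥ 0`).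
[folklore] -/
theorem abs_clamp_le_abs {k : ℝ} (hk : 0 ≤ k) (x : ℝ) : |max (-k) (min k x)| ≤ |x| := by
  rcases le_total x k with h | h
  · rw [min_eq_right h]
    rcases le_total (-k) x with h' | h'
    · rw [max_eq_right h']
    · rw [max_eq_left h', abs_neg, abs_of_nonneg hk, abs_of_nonpos (h'.trans (neg_nonpos.2 hk))]
      linarith
  · rw [min_eq_left h, max_eq_right (by linarith : -k ≤ k), abs_of_nonneg hk, abs_of_nonneg (hk.trans h)]
    exact h

/-- The one-dimensional clamp does not increase distances. [folklore] -/
theorem abs_clamp_sub_clamp_le (k x y : ℝ) : |max (-k) (min k x) - max (-k) (min k y)| ≤ |x - y| := by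
  have h := ((LipschitzWith.id.const_min k).const_max (-k)).dist_le_mul x y
  rwa [NNReal.coe_one, one_mul, Real.dist_eq, Real.dist_eq] at h

/-- The clamp fixes the disc of radius `k` (indeed the square `|Re z|, |Im z| ≤ k`). [folklore] -/
theorem _root_.Literature.Analysis.OperatorTheory.clampC_eq_self {k : ℝ} {z : ℂ} (h : ‖z‖ ≤ k) :
    clampC k z = z := by
  have hre := abs_le.1 ((Complex.abs_re_le_norm z).trans h)
  have him := abs_le.1 ((Complex.abs_im_le_norm z).trans h)
  apply Complex.ext
  · rw [clampC_re, min_eq_right hre.2, max_eq_right hre.1]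
  · rw [clampC_im, min_eq_right him.2, max_eq_right him.1]

/-- `clampC k 0 = 0` (`k ≥ 0`). [folklore] -/
theorem _root_.Literature.Analysis.OperatorTheory.clampC_zero {k : ℝ} (hk : 0 ≤ k) : clampC k 0 = 0 :=
  clampC_eq_self (by rwa [norm_zero])

/-- **The complex clamp is `1`-Lipschitz.** [folklore] -/
theorem _root_.Literature.Analysis.OperatorTheory.lipschitzWith_clampC (k : ℝ) :
    LipschitzWith 1 (clampC k) := by
  refine LipschitzWith.of_dist_le_mul fun z w => ?_
  rw [NNReal.coe_one, one_mul, Complex.dist_eq_re_im, Complex.dist_eq_re_im, clampC_re, clampC_re,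
    clampC_im, clampC_im]
  exact Real.sqrt_le_sqrt (add_le_add (sq_le_sq.2 (abs_clamp_sub_clamp_le k z.re w.re))
    (sq_le_sq.2 (abs_clamp_sub_clamp_le k z.im w.im)))

/-- `‖clampC k z‖ ≤ ‖z‖` (`k ≥ 0`). [folklore] -/
theorem _root_.Literature.Analysis.OperatorTheory.norm_clampC_le_norm {k : ℝ} (hk : 0 ≤ k) (z : ℂ) :
    ‖clampC k z‖ ≤ ‖z‖ := by
  rw [← sq_le_sq₀ (norm_nonneg _) (norm_nonneg _), Complex.sq_norm, Complex.sq_norm,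
    Complex.normSq_apply, Complex.normSq_apply, clampC_re, clampC_im]
  have h1 := mul_self_le_mul_self (abs_nonneg _) (abs_clamp_le_abs hk z.re)
  have h2 := mul_self_le_mul_self (abs_nonneg _) (abs_clamp_le_abs hk z.im)
  rw [abs_mul_abs_self, abs_mul_abs_self] at h1 h2
  exact add_le_add h1 h2

/-- `clampC k z → z` as `k → ∞` (the sequence is eventually constant). [folklore] -/
theorem _root_.Literature.Analysis.OperatorTheory.tendsto_clampC (z : ℂ) :
    Tendsto (fun k : ℕ => clampC k z) atTop (𝓝 z) := by
  obtain ⟨k₀, hk₀⟩ := exists_nat_ge ‖z‖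
  refine tendsto_const_nhds.congr' ?_
  filter_upwards [eventually_ge_atTop k₀] with k hk
  exact (clampC_eq_self (hk₀.trans (by exact_mod_cast hk))).symm

end Clamp

namespace Torus

variable {d : Type*} [Fintype d]

/-! ## The difference-quotient weight `(m sinc(π m s))²` -/

/-- `(m sinc(π m s))² ≤ m²` (`|sinc| ≤ 1`). [folklore] -/
theorem sq_mul_sinc_le (m : ℤ) (s : ℝ) : ((m : ℝ) * Real.sinc (Real.pi * m * s)) ^ 2 ≤ (m : ℝ) ^ 2 := by
  rw [mul_pow]
  have h2 : Real.sinc (Real.pi * m * s) ^ 2 ≤ 1 := by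
    rw [← sq_abs]
    exact pow_le_one₀ (abs_nonneg _) (Real.abs_sinc_le_one _)
  exact mul_le_of_le_one_right (sq_nonneg _) h2

/-- `(m sinc(π m sⱼ))² → m²` along any `sⱼ → 0`. [folklore] -/
theorem tendsto_sq_mul_sinc (m : ℤ) {s : ℕ → ℝ} (hs : Tendsto s atTop (𝓝 0)) :
    Tendsto (fun j => ((m : ℝ) * Real.sinc (Real.pi * m * s j)) ^ 2) atTop (𝓝 ((m : ℝ) ^ 2)) := by
  have h1 : Tendsto (fun j => Real.pi * m * s j) atTop (𝓝 0) := by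
    simpa using hs.const_mul (Real.pi * m)
  have h2 : Tendsto (fun j => Real.sinc (Real.pi * m * s j)) atTop (𝓝 1) := by
    rw [← Real.sinc_zero]
    exact (Real.continuous_sinc.tendsto 0).comp h1
  have h3 := (h2.const_mul (m : ℝ)).pow 2
  rw [mul_one] at h3
  exact h3

/-- `‖exp(i · 2π m s) - 1‖² = (2π s)² (m sinc(π m s))²` (`|e^{iy} - 1| = 2|sin(y/2)|` and
`sin x = x sinc x`). [folklore] -/
theorem norm_exp_sub_one_sq_eq (m : ℤ) (s : ℝ) :
    ‖Complex.exp (Complex.I * ((2 * Real.pi * m * s : ℝ) : ℂ)) - 1‖ ^ 2 =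
      (2 * Real.pi * s) ^ 2 * ((m : ℝ) * Real.sinc (Real.pi * m * s)) ^ 2 := by
  rw [Complex.norm_exp_I_mul_ofReal_sub_one]
  have h1 : (2 * Real.pi * m * s) / 2 = Real.pi * m * s := by ring
  have h2 : Real.sin (Real.pi * m * s) = Real.pi * m * s * Real.sinc (Real.pi * m * s) := by
    rcases eq_or_ne (Real.pi * m * s) 0 with h0 | h0
    · rw [h0, Real.sin_zero, zero_mul]
    · rw [Real.sinc_of_ne_zero h0, mul_div_cancel₀ _ h0]
  rw [h1, h2, Real.norm_eq_abs, sq_abs]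
  ring

variable [DecidableEq d]

/-- The character at a one-coordinate translation: `e_n(s 𝐞ₚ) = exp(i · 2π nₚ s)`. [folklore] -/
theorem mFourier_single_coe (n : d → ℤ) (p : d) (s : ℝ) :
    mFourier n (Pi.single p ((s : ℝ) : UnitAddCircle) : UnitAddTorus d) =
      Complex.exp (Complex.I * ((2 * Real.pi * (n p) * s : ℝ) : ℂ)) := by
  simp only [mFourier, ContinuousMap.coe_mk]
  rw [Finset.prod_eq_single p]
  · rw [Pi.single_eq_same, fourier_coe_apply]
    congr 1
    push_cast
    ring
  · intro q _ hq
    rw [Pi.single_eq_of_ne hq, fourier_eval_zero]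
  · intro h
    exact absurd (Finset.mem_univ p) h

/-- `‖e_n(s 𝐞ₚ) - 1‖ₑ² = ofReal((2πs)²) · ofReal((nₚ sinc(π nₚ s))²)`. [folklore] -/
theorem enorm_mFourier_single_sub_one_sq (n : d → ℤ) (p : d) (s : ℝ) :
    ‖mFourier n (Pi.single p ((s : ℝ) : UnitAddCircle) : UnitAddTorus d) - 1‖ₑ ^ 2 =
      ENNReal.ofReal ((2 * Real.pi * s) ^ 2) *
        ENNReal.ofReal (((n p : ℝ) * Real.sinc (Real.pi * (n p) * s)) ^ 2) := by
  rw [mFourier_single_coe, ← ofReal_norm, ← ENNReal.ofReal_pow (norm_nonneg _),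
    norm_exp_sub_one_sq_eq, ENNReal.ofReal_mul (sq_nonneg _)]

/-! ## Lipschitz maps and translation differences -/

omit [DecidableEq d] in
/-- A `K`-Lipschitz map contracts increments pointwise, hence
`∫ ‖(Φ∘g)(· + a) - Φ∘g‖ₑ² ≤ K² ∫ ‖g(· + a) - g‖ₑ²`. [folklore] -/
theorem lintegral_enorm_comp_sub_translate_sq_le {E F : Type*} [NormedAddCommGroup E]
    [NormedAddCommGroup F] {Φ : E → F} {K : ℝ≥0} (hΦ : LipschitzWith K Φ) (g : UnitAddTorus d → E)
    (a : UnitAddTorus d) :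
    ∫⁻ x, ‖Φ (g (x + a)) - Φ (g x)‖ₑ ^ 2 ≤ (K : ℝ≥0∞) ^ 2 * ∫⁻ x, ‖g (x + a) - g x‖ₑ ^ 2 := by
  rw [← lintegral_const_mul' _ _ (ENNReal.pow_ne_top ENNReal.coe_ne_top)]
  refine lintegral_mono fun x => ?_
  rw [← mul_pow]
  gcongr
  rw [← edist_eq_enorm_sub, ← edist_eq_enorm_sub]
  exact hΦ.edist_le_mul _ _

omit [DecidableEq d] in
/-- Spectral form of the contraction of increments: for every translation `a`,
`∑ₙ |e_n(a) - 1|² ‖𝓕(Φ∘g)(n)‖² ≤ K² ∑ₙ |e_n(a) - 1|² ‖𝓕g(n)‖²`. [folklore] -/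
theorem tsum_translate_weight_comp_le {Φ : ℂ → ℂ} {K : ℝ≥0} (hΦ : LipschitzWith K Φ) (h0 : Φ 0 = 0)
    {g : UnitAddTorus d → ℂ} (hg : MemLp g 2 volume) (a : UnitAddTorus d) :
    ∑' n : d → ℤ, ‖mFourier n a - 1‖ₑ ^ 2 * ‖mFourierCoeff (Φ ∘ g) n‖ₑ ^ 2 ≤
      (K : ℝ≥0∞) ^ 2 * ∑' n : d → ℤ, ‖mFourier n a - 1‖ₑ ^ 2 * ‖mFourierCoeff g n‖ₑ ^ 2 := by
  have hΦg : MemLp (Φ ∘ g) 2 volume := hΦ.comp_memLp h0 hg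
  rw [← lintegral_enorm_sub_translate_sq_eq_tsum hΦg a, ← lintegral_enorm_sub_translate_sq_eq_tsum hg a]
  exact lintegral_enorm_comp_sub_translate_sq_le hΦ g a

/-- At the one-coordinate translation `s 𝐞ₚ`, `s ≠ 0`, after cancelling `(2πs)²`:
`∑ₙ (nₚ sinc(π nₚ s))² ‖𝓕(Φ∘g)(n)‖² ≤ K² ∑ₙ (nₚ sinc(π nₚ s))² ‖𝓕g(n)‖²`. [folklore] -/
theorem tsum_sincWeight_comp_le {Φ : ℂ → ℂ} {K : ℝ≥0} (hΦ : LipschitzWith K Φ) (h0 : Φ 0 = 0)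
    {g : UnitAddTorus d → ℂ} (hg : MemLp g 2 volume) (p : d) {s : ℝ} (hs : s ≠ 0) :
    ∑' n : d → ℤ, ENNReal.ofReal (((n p : ℝ) * Real.sinc (Real.pi * (n p) * s)) ^ 2) *
        ‖mFourierCoeff (Φ ∘ g) n‖ₑ ^ 2 ≤
      (K : ℝ≥0∞) ^ 2 * ∑' n : d → ℤ, ENNReal.ofReal (((n p : ℝ) * Real.sinc (Real.pi * (n p) * s)) ^ 2) *
        ‖mFourierCoeff g n‖ₑ ^ 2 := by
  have h := tsum_translate_weight_comp_le hΦ h0 hg (Pi.single p ((s : ℝ) : UnitAddCircle))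
  simp only [enorm_mFourier_single_sub_one_sq] at h
  simp_rw [mul_assoc (ENNReal.ofReal ((2 * Real.pi * s) ^ 2)), ENNReal.tsum_mul_left] at h
  rw [mul_left_comm ((K : ℝ≥0∞) ^ 2) (ENNReal.ofReal ((2 * Real.pi * s) ^ 2))] at h
  have hc : ENNReal.ofReal ((2 * Real.pi * s) ^ 2) ≠ 0 := by
    rw [Ne, ENNReal.ofReal_eq_zero, not_le]
    exact sq_pos_iff.2 (mul_ne_zero (mul_ne_zero two_ne_zero Real.pi_pos.ne') hs)
  exact (ENNReal.mul_le_mul_iff_right hc ENNReal.ofReal_ne_top).1 h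

/-- **Lipschitz maps contract the spectral `H¹` seminorms, one coordinate at a time**
(Gilbarg–Trudinger Lemma 7.6 / Thm. 7.8 in Fourier dress): for `g ∈ L²(T^d; ℂ)`, a `K`-Lipschitz
`Φ : ℂ → ℂ` with `Φ 0 = 0` and a coordinate `p`,
`∑ₙ nₚ² ‖𝓕(Φ ∘ g)(n)‖² ≤ K² ∑ₙ nₚ² ‖𝓕g(n)‖²` in `[0, ∞]`. [cite: GilbargTrudinger2001, Lemma 7.6] -/
theorem tsum_sq_mul_enorm_mFourierCoeff_comp_le {Φ : ℂ → ℂ} {K : ℝ≥0} (hΦ : LipschitzWith K Φ)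
    (h0 : Φ 0 = 0) {g : UnitAddTorus d → ℂ} (hg : MemLp g 2 volume) (p : d) :
    ∑' n : d → ℤ, ENNReal.ofReal ((n p : ℝ) ^ 2) * ‖mFourierCoeff (Φ ∘ g) n‖ₑ ^ 2 ≤
      (K : ℝ≥0∞) ^ 2 * ∑' n : d → ℤ, ENNReal.ofReal ((n p : ℝ) ^ 2) * ‖mFourierCoeff g n‖ₑ ^ 2 := by
  set R : ℝ≥0∞ := (K : ℝ≥0∞) ^ 2 *
    ∑' n : d → ℤ, ENNReal.ofReal ((n p : ℝ) ^ 2) * ‖mFourierCoeff g n‖ₑ ^ 2 with hR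
  -- the steps `sⱼ = 1/(j+1) → 0`
  set s : ℕ → ℝ := fun j => 1 / ((j : ℝ) + 1) with hs_def
  have hs0 : ∀ j, s j ≠ 0 := fun j => one_div_ne_zero (by positivity)
  have hslim : Tendsto s atTop (𝓝 0) := tendsto_one_div_add_atTop_nhds_zero_nat
  -- at every step the weighted sum for `Φ ∘ g` is bounded by `R`
  have hstep : ∀ j, ∑' n : d → ℤ, ENNReal.ofReal (((n p : ℝ) * Real.sinc (Real.pi * (n p) * s j)) ^ 2) *
      ‖mFourierCoeff (Φ ∘ g) n‖ₑ ^ 2 ≤ R := fun j =>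
    (tsum_sincWeight_comp_le hΦ h0 hg p (hs0 j)).trans
      (mul_le_mul_right (ENNReal.tsum_le_tsum fun n => mul_le_mul_left
        (ENNReal.ofReal_le_ofReal (sq_mul_sinc_le _ _)) _) _)
  -- pass to the limit `j → ∞` on finite partial sums
  rw [ENNReal.tsum_eq_iSup_sum]
  refine iSup_le fun S => ?_
  have hlim : Tendsto (fun j => ∑ n ∈ S, ENNReal.ofReal (((n p : ℝ) * Real.sinc (Real.pi * (n p) * s j)) ^ 2) *
      ‖mFourierCoeff (Φ ∘ g) n‖ₑ ^ 2) atTop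
      (𝓝 (∑ n ∈ S, ENNReal.ofReal ((n p : ℝ) ^ 2) * ‖mFourierCoeff (Φ ∘ g) n‖ₑ ^ 2)) := by
    refine tendsto_finsetSum _ fun n _ => ?_
    exact ENNReal.Tendsto.mul_const ((ENNReal.continuous_ofReal.tendsto _).comp
      (tendsto_sq_mul_sinc (n p) hslim)) (Or.inr (ENNReal.pow_ne_top enorm_ne_top))
  exact le_of_tendsto' hlim fun j => (ENNReal.sum_le_tsum S).trans (hstep j)

/-- **Weighted form** (coordinate weights `cₚ ≥ 0`, e.g. `cₚ = (2π/L)²` for the kinetic energy on a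
torus of side `L`): `∑ₙ (∑ₚ cₚ nₚ²) ‖𝓕(Φ ∘ g)(n)‖² ≤ K² ∑ₙ (∑ₚ cₚ nₚ²) ‖𝓕g(n)‖²`.
[cite: GilbargTrudinger2001, Thm. 7.8] -/
theorem tsum_weight_mul_enorm_mFourierCoeff_comp_le {Φ : ℂ → ℂ} {K : ℝ≥0} (hΦ : LipschitzWith K Φ)
    (h0 : Φ 0 = 0) {g : UnitAddTorus d → ℂ} (hg : MemLp g 2 volume) {c : d → ℝ} (hc : ∀ p, 0 ≤ c p) :
    ∑' n : d → ℤ, ENNReal.ofReal (∑ p, c p * (n p : ℝ) ^ 2) * ‖mFourierCoeff (Φ ∘ g) n‖ₑ ^ 2 ≤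
      (K : ℝ≥0∞) ^ 2 *
        ∑' n : d → ℤ, ENNReal.ofReal (∑ p, c p * (n p : ℝ) ^ 2) * ‖mFourierCoeff g n‖ₑ ^ 2 := by
  have hsplit : ∀ G : (d → ℤ) → ℝ≥0∞, ∑' n, ENNReal.ofReal (∑ p, c p * (n p : ℝ) ^ 2) * G n =
      ∑ p, ENNReal.ofReal (c p) * ∑' n : d → ℤ, ENNReal.ofReal ((n p : ℝ) ^ 2) * G n := by
    intro G
    simp_rw [ENNReal.ofReal_sum_of_nonneg (fun p _ => mul_nonneg (hc p) (sq_nonneg _)), Finset.sum_mul]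
    rw [Summable.tsum_finsetSum (fun _ _ => ENNReal.summable)]
    refine Finset.sum_congr rfl fun p _ => ?_
    rw [← ENNReal.tsum_mul_left]
    refine tsum_congr fun n => ?_
    rw [ENNReal.ofReal_mul (hc p), mul_assoc]
  rw [hsplit, hsplit, Finset.mul_sum]
  refine Finset.sum_le_sum fun p _ => ?_
  rw [mul_left_comm]
  exact mul_le_mul_right (tsum_sq_mul_enorm_mFourierCoeff_comp_le hΦ h0 hg p) _

/-- **`1`-Lipschitz maps contract the weighted kinetic energy** (`K = 1`).
[cite: GilbargTrudinger2001, Thm. 7.8] -/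
theorem tsum_weight_mul_enorm_mFourierCoeff_comp_le_of_one {Φ : ℂ → ℂ} (hΦ : LipschitzWith 1 Φ)
    (h0 : Φ 0 = 0) {g : UnitAddTorus d → ℂ} (hg : MemLp g 2 volume) {c : d → ℝ} (hc : ∀ p, 0 ≤ c p) :
    ∑' n : d → ℤ, ENNReal.ofReal (∑ p, c p * (n p : ℝ) ^ 2) * ‖mFourierCoeff (Φ ∘ g) n‖ₑ ^ 2 ≤
      ∑' n : d → ℤ, ENNReal.ofReal (∑ p, c p * (n p : ℝ) ^ 2) * ‖mFourierCoeff g n‖ₑ ^ 2 := by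
  simpa only [ENNReal.coe_one, one_pow, one_mul] using
    tsum_weight_mul_enorm_mFourierCoeff_comp_le hΦ h0 hg hc

/-- **The clamp truncation contracts the weighted kinetic energy**: for `g ∈ L²(T^d; ℂ)`, `k ≥ 0`,
`∑ₙ (∑ₚ cₚ nₚ²) ‖𝓕(clampC k ∘ g)(n)‖² ≤ ∑ₙ (∑ₚ cₚ nₚ²) ‖𝓕g(n)‖²`. [cite: GilbargTrudinger2001, Lemma 7.6] -/
theorem tsum_weight_mul_enorm_mFourierCoeff_clampC_le {k : ℝ} (hk : 0 ≤ k) {g : UnitAddTorus d → ℂ}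
    (hg : MemLp g 2 volume) {c : d → ℝ} (hc : ∀ p, 0 ≤ c p) :
    ∑' n : d → ℤ, ENNReal.ofReal (∑ p, c p * (n p : ℝ) ^ 2) * ‖mFourierCoeff (clampC k ∘ g) n‖ₑ ^ 2 ≤
      ∑' n : d → ℤ, ENNReal.ofReal (∑ p, c p * (n p : ℝ) ^ 2) * ‖mFourierCoeff g n‖ₑ ^ 2 :=
  tsum_weight_mul_enorm_mFourierCoeff_comp_le_of_one (lipschitzWith_clampC k) (clampC_zero hk) hg hc

end Torus

end Literature.Analysis.FunctionSpaces

end
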